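import Literature.MathematicalPhysics.QuantumFieldTheory.Balaban1983to89.B4Eq19LatticeCaccioppoli
import Literature.MathematicalPhysics.QuantumFieldTheory.Balaban1983to89.B4Eq19LatticeMixedSobolev

/-!
# `Balaban1983to89.B4Eq19LatticeHarmonicDecay` — T. Bałaban, *Propagators and renormalization transformations for lattice gauge theories. II*,
# Commun. Math. Phys. **96** (1984) 223–250 [Balaban1984PropagatorsII] (1.9) p. 226: **INTERIOR ESTIMATES FOR `κ`-HARMONIC FUNCTIONS ON `ℤ^d`** —
# the iterated Caccioppoli inequality for mixed differences, the SUP BOUND `|∇h(x)|² ≤ C_d (ℓ+1)^{−d} Σ_{Q} |∇h|²`, and the ENERGY DECAY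
# `Σ_{Q_ρ(z)} |∇h|² ≤ A_d ((ρ+1)∕(r+1))^d Σ_{Q_r(z)} |∇h|²` (`0 ≤ ρ ≤ r`, `h` `κ`-harmonic on `Q_{r+1}(z)`, `κ ≥ 0`) — the decay estimate of the Campanato road
# ([Giaquinta1984] Ch. III §2, (2.5) p. 78) to the LOCAL η-scale Hölder estimate `Hloc` of `B9Eq343FlatWindowLetterOfLocalHolder`.

statement-level skeleton of published theorems with citation tags; proofs where landed; nothing here is a claim about the Yang–Mills mass gap

CITATION HEADER (lean-in-tree rule).  Audit cell `pub-balaban`, sub-cell `t4`, BINDER row NE9; filed by NE9 crux-team LEAF PROVER 01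
(`b2b-balaban-t4-ne9-formalise-leaf-01`, gen 94; bears_on: R4/N22).  CONTENT: [folklore] lattice analysis — on `ℤ^d` every forward difference of a
`κ`-harmonic function is `κ`-harmonic, so Caccioppoli iterates on `∂_S`, and the mixed-difference Sobolev embedding of `B4Eq19LatticeMixedSobolev` turns the
`L²` bounds into a sup bound (the lattice replaces [Giaquinta1984] Ch. III (2.5)'s appeal to elliptic `H^k` regularity).  Nothing of [Balaban1984PropagatorsII]
is asserted.

WHAT IS PROVED (sorry-free; proof lane — 0 `def`).
* `sum_cube_le_sum_box` (bookkeeping); **`sum_sq_fdS_le`** — `Σ_{Q_ρ(z)} (∂_S F)² ≤ (14d∕ℓ²)^{|S|} Σ_{Q_{ρ+|S|(ℓ+2)}(z)} F²` for `F` `κ`-harmonic there.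
* **`sq_fdiff_le_of_harmonic`** — `(∂_ν h(x))² ≤ 2^d(1+56d)^d (ℓ+1)^{−d} · gradSq h (Q_{ρ₀+ℓ+d(ℓ+2)}(z))` for `x ∈ Q_{ρ₀}(z)`, `h` `κ`-harmonic on
  `Q_{ρ₀+ℓ+d(ℓ+2)+1}(z)`, `ℓ ≥ 1`.
* **`gradSq_le_of_harmonic`** — `gradSq h (Q_ρ(z)) ≤ d·2^d(1+56d)^d (2ρ+1)^d (ℓ+1)^{−d} gradSq h (Q_{ρ+ℓ+d(ℓ+2)}(z))`.
* **`harmonic_decay`** — THE DECAY ESTIMATE: `gradSq h (Q_ρ(z)) ≤ A_d ((ρ+1)∕(r+1))^d gradSq h (Q_r(z))`, `A_d = 2^d(1+56d)^d(8(d+1))^{d+1}`, for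
  `0 ≤ ρ ≤ r` and `h` `κ`-harmonic on `Q_{r+1}(z)`.
HONEST SCOPE.  [folklore] lattice analysis on `ℤ^d`; one step of the road to `Hloc`; NOT summit progress (cell pub-balaban: NE9 NOT PRINTED ∕ NOT PROVED;
spine PROVED 0∕9; finite T⁴ — NOT infinite volume, NOT mass gap, NOT BetaPertH, NOT Clay).  NEW file importing `B4Eq19LatticeCaccioppoli` and
`B4Eq19LatticeMixedSobolev`.  Net new unproved facts: 0.
-/

noncomputable section

open scoped BigOperators
open Finset

namespace Literature.MathematicalPhysics.QuantumFieldTheory.Balaban1983to89.B4Eq19LatticeHarmonicDecay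

open B4Eq19LatticeOperators B4Eq19LatticeCaccioppoli B4Eq19LatticeMixedSobolev

variable {d : ℕ}

/-! ## §1 Iterated Caccioppoli for mixed differences -/

/-- A cube sum of a nonnegative function from a point of `Q_{ρ₀}(z)` is at most its sum over `Q_{ρ₀+ℓ}(z)`. [folklore]
[cite: Giaquinta1984, Ch. III §1 p.64] -/
theorem sum_cube_le_sum_box {T : Finset (Fin d)} {ℓ : ℕ} {G : Zd d → ℝ} (hG : ∀ y, 0 ≤ G y) {z x : Zd d} {ρ₀ : ℤ} (hx : x ∈ box z ρ₀) :
    ∑ v ∈ cube T ℓ, G (x + v) ≤ ∑ y ∈ box z (ρ₀ + ℓ), G y := by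
  classical
  have h1 : ∑ v ∈ cube T ℓ, G (x + v) = ∑ y ∈ (cube T ℓ).map (addLeftEmbedding x), G y := by
    rw [Finset.sum_map]; rfl
  rw [h1]
  refine Finset.sum_le_sum_of_subset_of_nonneg (fun y hy => ?_) fun _ _ _ => hG _
  rw [Finset.mem_map] at hy
  obtain ⟨v, hv, rfl⟩ := hy
  exact add_mem_box_of_mem_cube hv hx

/-- **ITERATED CACCIOPPOLI FOR MIXED DIFFERENCES**: for `κ ≥ 0`, `ℓ ≥ 1`, `ρ ≥ 0` and `F` `κ`-harmonic on `Q_{ρ + |S|(ℓ+2)}(z)`,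
`Σ_{y ∈ Q_ρ(z)} (∂_S F(y))² ≤ (14d∕ℓ²)^{|S|} Σ_{y ∈ Q_{ρ+|S|(ℓ+2)}(z)} F(y)²` (`∂_S` of a `κ`-harmonic function is `κ`-harmonic; induct on `S`).
[folklore] [cite: Giaquinta1984, Ch. III §2 (2.5) p.78] -/
theorem sum_sq_fdS_le {κ : ℝ} (hκ : 0 ≤ κ) {z : Zd d} {ℓ : ℕ} (hℓ : 1 ≤ ℓ) (S : Finset (Fin d)) :
    ∀ (F : Zd d → ℝ) (ρ : ℤ), 0 ≤ ρ → (∀ y ∈ box z (ρ + S.card * ((ℓ : ℤ) + 2)), lop κ F y = 0) →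
      ∑ y ∈ box z ρ, fdS S F y ^ 2 ≤ (14 * d / (ℓ : ℝ) ^ 2) ^ S.card * ∑ y ∈ box z (ρ + S.card * ((ℓ : ℤ) + 2)), F y ^ 2 := by
  classical
  induction S using Finset.induction_on with
  | empty =>
    intro F ρ _ _
    simp [fdS_empty]
  | insert j S hj ih =>
    intro F ρ hρ hF
    have hcard : ((insert j S).card : ℤ) = S.card + 1 := by rw [Finset.card_insert_of_notMem hj]; push_cast; ring
    -- `G = ∂_S F` is harmonic on `Q_{ρ + ℓ + 2 + ... }`, in particular on `Q_{ρ+ℓ}`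
    have hG : ∀ y ∈ box z (ρ + ℓ), lop κ (fdS S F) y = 0 := by
      refine lop_fdS_eq_zero_of_harmonic S F (ρ + ℓ) (fun y hy => hF y (box_mono z ?_ hy))
      rw [hcard]
      have : (0 : ℤ) ≤ S.card := by positivity
      nlinarith
    -- one Caccioppoli step on `G`
    have hC := caccioppoli_harmonic hκ (fdS S F) z hρ (by exact_mod_cast hℓ : (1 : ℤ) ≤ (ℓ : ℤ)) hG
    have h1 : ∑ y ∈ box z ρ, fdS (insert j S) F y ^ 2 ≤ gradSq (fdS S F) (box z ρ) := by
      rw [gradSq_def]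
      refine Finset.sum_le_sum fun y _ => ?_
      rw [fdS_insert hj]
      exact Finset.single_le_sum (f := fun μ => fdiff μ (fdS S F) y ^ 2) (fun _ _ => sq_nonneg _) (Finset.mem_univ j)
    -- the induction hypothesis on the bigger box
    have hρ' : (0 : ℤ) ≤ ρ + ℓ + 2 := by positivity
    have h2 := ih F (ρ + ℓ + 2) hρ' (fun y hy => hF y (by
      rw [hcard, show ρ + ((S.card : ℤ) + 1) * ((ℓ : ℤ) + 2) = ρ + ℓ + 2 + S.card * ((ℓ : ℤ) + 2) by ring]; exact hy))
    have hc0 : (0 : ℝ) ≤ 14 * d / (ℓ : ℝ) ^ 2 := by positivity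
    calc ∑ y ∈ box z ρ, fdS (insert j S) F y ^ 2 ≤ gradSq (fdS S F) (box z ρ) := h1
      _ ≤ (14 * d / (ℓ : ℝ) ^ 2) * ∑ y ∈ box z (ρ + ℓ + 2), fdS S F y ^ 2 := hC
      _ ≤ (14 * d / (ℓ : ℝ) ^ 2) * ((14 * d / (ℓ : ℝ) ^ 2) ^ S.card * ∑ y ∈ box z (ρ + ℓ + 2 + S.card * ((ℓ : ℤ) + 2)), F y ^ 2) :=
          mul_le_mul_of_nonneg_left h2 hc0
      _ = (14 * d / (ℓ : ℝ) ^ 2) ^ (insert j S).card * ∑ y ∈ box z (ρ + (insert j S).card * ((ℓ : ℤ) + 2)), F y ^ 2 := by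
          rw [Finset.card_insert_of_notMem hj, pow_succ]
          have e : ρ + ℓ + 2 + (S.card : ℤ) * ((ℓ : ℤ) + 2) = ρ + ((S.card + 1 : ℕ) : ℤ) * ((ℓ : ℤ) + 2) := by push_cast; ring
          rw [e]; ring

/-! ## §2 The sup bound for the gradient of a `κ`-harmonic function -/

/-- **SUP BOUND**: for `κ ≥ 0`, `ℓ ≥ 1`, `ρ₀ ≥ 0`, `x ∈ Q_{ρ₀}(z)` and `h` `κ`-harmonic on `Q_{ρ₀+ℓ+d(ℓ+2)+1}(z)`,
`(∂_ν h(x))² ≤ 2^d (1+56d)^d (ℓ+1)^{−d} · gradSq h (Q_{ρ₀+ℓ+d(ℓ+2)}(z))` (mixed Sobolev embedding of `∂_ν h` on the cube `x + [0,ℓ]^d`, then iterated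
Caccioppoli; `(ℓ+1)²∕ℓ² ≤ 4` and `Σ_{S} (56d)^{|S|} = (1+56d)^d`). [folklore] [cite: Giaquinta1984, Ch. III §2 (2.5) p.78] -/
theorem sq_fdiff_le_of_harmonic {κ : ℝ} (hκ : 0 ≤ κ) {z : Zd d} {ℓ : ℕ} (hℓ : 1 ≤ ℓ) {ρ₀ : ℤ} (hρ₀ : 0 ≤ ρ₀) (h : Zd d → ℝ)
    (hh : ∀ y ∈ box z (ρ₀ + ℓ + d * ((ℓ : ℤ) + 2) + 1), lop κ h y = 0) {x : Zd d} (hx : x ∈ box z ρ₀) (ν : Fin d) :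
    fdiff ν h x ^ 2 ≤ (2 : ℝ) ^ d * (1 + 56 * d) ^ d / ((ℓ : ℝ) + 1) ^ d * gradSq h (box z (ρ₀ + ℓ + d * ((ℓ : ℤ) + 2))) := by
  classical
  set F : Zd d → ℝ := fdiff ν h with hFdef
  set E := gradSq h (box z (ρ₀ + ℓ + d * ((ℓ : ℤ) + 2))) with hEdef
  have hE0 : 0 ≤ E := gradSq_nonneg _ _
  have hl : (0 : ℝ) < (ℓ : ℝ) + 1 := by positivity
  have hl1 : (1 : ℝ) ≤ ℓ := by exact_mod_cast hℓ
  -- `F` is harmonic on `Q_{ρ₀+ℓ+d(ℓ+2)}`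
  have hF : ∀ y ∈ box z (ρ₀ + ℓ + d * ((ℓ : ℤ) + 2)), lop κ F y = 0 := fun y hy =>
    lop_fdiff_eq_zero hh ν (box_mono z (by linarith) hy) (add_unitVec_mem_box hy ν)
  -- Sobolev on the full set of directions
  have hS := sq_le_sum_powerset_cube (Finset.univ : Finset (Fin d)) F x ℓ
  rw [Finset.card_univ, Fintype.card_fin] at hS
  -- each subset term
  have hterm : ∀ S ∈ (Finset.univ : Finset (Fin d)).powerset,
      (((ℓ : ℝ) + 1) ^ (2 * S.card) / ((ℓ : ℝ) + 1) ^ d) * ∑ v ∈ cube Finset.univ ℓ, fdS S F (x + v) ^ 2 ≤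
        ((56 * d : ℝ) ^ S.card / ((ℓ : ℝ) + 1) ^ d) * E := by
    intro S _
    have hSd : S.card ≤ d := by simpa using Finset.card_le_univ S
    -- cube → box
    have h1 : ∑ v ∈ cube Finset.univ ℓ, fdS S F (x + v) ^ 2 ≤ ∑ y ∈ box z (ρ₀ + ℓ), fdS S F y ^ 2 :=
      sum_cube_le_sum_box (G := fun y => fdS S F y ^ 2) (fun _ => sq_nonneg _) hx
    -- iterated Caccioppoli
    have hρ1 : (0 : ℤ) ≤ ρ₀ + ℓ := by positivity
    have h2 := sum_sq_fdS_le hκ hℓ S F (ρ₀ + ℓ) hρ1 (fun y hy => hF y (box_mono z (by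
      have : (S.card : ℤ) * ((ℓ : ℤ) + 2) ≤ d * ((ℓ : ℤ) + 2) := mul_le_mul_of_nonneg_right (by exact_mod_cast hSd) (by positivity)
      linarith) hy))
    have h3 : ∑ y ∈ box z (ρ₀ + ℓ + S.card * ((ℓ : ℤ) + 2)), F y ^ 2 ≤ E := by
      calc ∑ y ∈ box z (ρ₀ + ℓ + S.card * ((ℓ : ℤ) + 2)), F y ^ 2
          ≤ ∑ y ∈ box z (ρ₀ + ℓ + d * ((ℓ : ℤ) + 2)), F y ^ 2 := Finset.sum_le_sum_of_subset_of_nonneg (box_mono z (by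
              have : (S.card : ℤ) * ((ℓ : ℤ) + 2) ≤ d * ((ℓ : ℤ) + 2) := mul_le_mul_of_nonneg_right (by exact_mod_cast hSd) (by positivity)
              linarith)) fun _ _ _ => sq_nonneg _
        _ ≤ E := by
            rw [hEdef, gradSq_def]
            refine Finset.sum_le_sum fun y _ => ?_
            exact Finset.single_le_sum (f := fun μ => fdiff μ h y ^ 2) (fun _ _ => sq_nonneg _) (Finset.mem_univ ν)
    have hc0 : (0 : ℝ) ≤ (14 * d / (ℓ : ℝ) ^ 2) ^ S.card := by positivity
    have h4 : ∑ v ∈ cube Finset.univ ℓ, fdS S F (x + v) ^ 2 ≤ (14 * d / (ℓ : ℝ) ^ 2) ^ S.card * E :=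
      h1.trans (h2.trans (mul_le_mul_of_nonneg_left h3 hc0))
    -- constants: `(ℓ+1)^{2s} (14d/ℓ²)^s ≤ (56d)^s`
    have h5 : ((ℓ : ℝ) + 1) ^ (2 * S.card) * (14 * d / (ℓ : ℝ) ^ 2) ^ S.card ≤ (56 * d : ℝ) ^ S.card := by
      rw [pow_mul, ← mul_pow]
      apply pow_le_pow_left₀ (by positivity)
      have hl2 : ((ℓ : ℝ) + 1) ^ 2 ≤ 4 * (ℓ : ℝ) ^ 2 := by nlinarith
      rw [mul_div_assoc', div_le_iff₀ (by positivity)]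
      nlinarith [Nat.cast_nonneg (α := ℝ) d]
    calc (((ℓ : ℝ) + 1) ^ (2 * S.card) / ((ℓ : ℝ) + 1) ^ d) * ∑ v ∈ cube Finset.univ ℓ, fdS S F (x + v) ^ 2
        ≤ (((ℓ : ℝ) + 1) ^ (2 * S.card) / ((ℓ : ℝ) + 1) ^ d) * ((14 * d / (ℓ : ℝ) ^ 2) ^ S.card * E) :=
          mul_le_mul_of_nonneg_left h4 (by positivity)
      _ = (((ℓ : ℝ) + 1) ^ (2 * S.card) * (14 * d / (ℓ : ℝ) ^ 2) ^ S.card) / ((ℓ : ℝ) + 1) ^ d * E := by ring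
      _ ≤ ((56 * d : ℝ) ^ S.card / ((ℓ : ℝ) + 1) ^ d) * E :=
          mul_le_mul_of_nonneg_right (div_le_div_of_nonneg_right h5 (by positivity)) hE0
  -- sum over subsets: `Σ_S (56d)^{|S|} = (1 + 56d)^d`
  have hsum : ∑ S ∈ (Finset.univ : Finset (Fin d)).powerset, ((56 * d : ℝ) ^ S.card / ((ℓ : ℝ) + 1) ^ d) * E =
      (1 + 56 * d) ^ d / ((ℓ : ℝ) + 1) ^ d * E := by
    rw [← Finset.sum_mul, ← Finset.sum_div]
    congr 2
    have := Finset.sum_pow_mul_eq_add_pow (56 * d : ℝ) 1 (Finset.univ : Finset (Fin d))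
    simp only [one_pow, mul_one, Finset.card_univ, Fintype.card_fin] at this
    rw [this, add_comm]
  calc F x ^ 2 ≤ (2 : ℝ) ^ d * ∑ S ∈ (Finset.univ : Finset (Fin d)).powerset,
        (((ℓ : ℝ) + 1) ^ (2 * S.card) / ((ℓ : ℝ) + 1) ^ d) * ∑ v ∈ cube Finset.univ ℓ, fdS S F (x + v) ^ 2 := hS
    _ ≤ (2 : ℝ) ^ d * ∑ S ∈ (Finset.univ : Finset (Fin d)).powerset, ((56 * d : ℝ) ^ S.card / ((ℓ : ℝ) + 1) ^ d) * E :=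
        mul_le_mul_of_nonneg_left (Finset.sum_le_sum hterm) (by positivity)
    _ = (2 : ℝ) ^ d * (1 + 56 * d) ^ d / ((ℓ : ℝ) + 1) ^ d * E := by rw [hsum]; ring

/-- **SUP BOUND, summed over a box**: `gradSq h (Q_ρ(z)) ≤ d·2^d(1+56d)^d·(2ρ+1)^d (ℓ+1)^{−d} · gradSq h (Q_{ρ+ℓ+d(ℓ+2)}(z))` for `κ ≥ 0`, `ℓ ≥ 1`,
`ρ ≥ 0`, `h` `κ`-harmonic on `Q_{ρ+ℓ+d(ℓ+2)+1}(z)`. [folklore] [cite: Giaquinta1984, Ch. III §2 (2.5) p.78] -/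
theorem gradSq_le_of_harmonic {κ : ℝ} (hκ : 0 ≤ κ) {z : Zd d} {ℓ : ℕ} (hℓ : 1 ≤ ℓ) {ρ : ℤ} (hρ : 0 ≤ ρ) (h : Zd d → ℝ)
    (hh : ∀ y ∈ box z (ρ + ℓ + d * ((ℓ : ℤ) + 2) + 1), lop κ h y = 0) :
    gradSq h (box z ρ) ≤ d * ((2 : ℝ) ^ d * (1 + 56 * d) ^ d) * ((2 * ρ + 1 : ℤ) : ℝ) ^ d / ((ℓ : ℝ) + 1) ^ d *
      gradSq h (box z (ρ + ℓ + d * ((ℓ : ℤ) + 2))) := by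
  set E := gradSq h (box z (ρ + ℓ + d * ((ℓ : ℤ) + 2))) with hEdef
  set C := (2 : ℝ) ^ d * (1 + 56 * d) ^ d / ((ℓ : ℝ) + 1) ^ d with hCdef
  have hpt : ∀ x ∈ box z ρ, ∑ ν : Fin d, fdiff ν h x ^ 2 ≤ d * (C * E) := by
    intro x hx
    calc ∑ ν : Fin d, fdiff ν h x ^ 2 ≤ ∑ ν : Fin d, C * E := Finset.sum_le_sum fun ν _ => by
            have := sq_fdiff_le_of_harmonic hκ hℓ hρ h hh hx ν; rw [hCdef]; exact this
      _ = d * (C * E) := by rw [Finset.sum_const, Finset.card_univ, Fintype.card_fin, nsmul_eq_mul]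
  rw [gradSq_def]
  calc ∑ x ∈ box z ρ, ∑ ν, fdiff ν h x ^ 2 ≤ ∑ x ∈ box z ρ, d * (C * E) := Finset.sum_le_sum hpt
    _ = (box z ρ).card * (d * (C * E)) := by rw [Finset.sum_const, nsmul_eq_mul]
    _ = d * ((2 : ℝ) ^ d * (1 + 56 * d) ^ d) * ((2 * ρ + 1 : ℤ) : ℝ) ^ d / ((ℓ : ℝ) + 1) ^ d * E := by
        rw [card_box z hρ, hCdef]; ring

/-! ## §3 The energy decay estimate -/

/-- **ENERGY DECAY FOR `κ`-HARMONIC FUNCTIONS ON `ℤ^d`.**  For `κ ≥ 0`, integers `0 ≤ ρ ≤ r`, and `h` `κ`-harmonic on `Q_{r+1}(z)`: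
`gradSq h (Q_ρ(z)) ≤ A_d · ((ρ+1)∕(r+1))^d · gradSq h (Q_r(z))` with `A_d = 2^d (1+56d)^d (8(d+1))^{d+1}` (if `r+1 ≤ 8(d+1)(ρ+1)` this is monotonicity;
otherwise take `ℓ = ⌊(r−ρ−2d)∕(d+1)⌋ ≥ 1` in `gradSq_le_of_harmonic`).  The lattice form of [Giaquinta1984] Ch. III (2.5).
[folklore] [cite: Giaquinta1984, Ch. III §2 (2.5) p.78; Balaban1984PropagatorsII, (1.9) p.226] -/
theorem harmonic_decay {κ : ℝ} (hκ : 0 ≤ κ) {z : Zd d} {ρ r : ℤ} (hρ : 0 ≤ ρ) (hρr : ρ ≤ r) (h : Zd d → ℝ)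
    (hh : ∀ y ∈ box z (r + 1), lop κ h y = 0) :
    gradSq h (box z ρ) ≤ (2 : ℝ) ^ d * (1 + 56 * d) ^ d * (8 * ((d : ℝ) + 1)) ^ (d + 1) * (((ρ : ℝ) + 1) / ((r : ℝ) + 1)) ^ d *
      gradSq h (box z r) := by
  set A₀ : ℝ := (2 : ℝ) ^ d * (1 + 56 * d) ^ d with hA₀
  have hA₀1 : 1 ≤ A₀ := by
    rw [hA₀]
    have h1 : (1 : ℝ) ≤ 2 ^ d := one_le_pow₀ (by norm_num)
    have h2 : (1 : ℝ) ≤ (1 + 56 * d) ^ d := one_le_pow₀ (by have := Nat.cast_nonneg (α := ℝ) d; linarith)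
    nlinarith
  have hEr : 0 ≤ gradSq h (box z r) := gradSq_nonneg _ _
  have hρ0 : (0 : ℝ) ≤ ρ := by exact_mod_cast hρ
  have hρr' : (ρ : ℝ) ≤ r := by exact_mod_cast hρr
  have hρ1 : (0 : ℝ) < (ρ : ℝ) + 1 := by linarith
  have hr1 : (0 : ℝ) < (r : ℝ) + 1 := by linarith
  have hd1 : (1 : ℝ) ≤ 8 * ((d : ℝ) + 1) := by have := Nat.cast_nonneg (α := ℝ) d; linarith
  by_cases hcase : (r : ℝ) + 1 ≤ 8 * ((d : ℝ) + 1) * ((ρ : ℝ) + 1)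
  · -- comparable radii: monotonicity
    have hmono : gradSq h (box z ρ) ≤ gradSq h (box z r) := gradSq_mono h (box_mono z hρr)
    have hfac : (1 : ℝ) ≤ A₀ * (8 * ((d : ℝ) + 1)) ^ (d + 1) * (((ρ : ℝ) + 1) / ((r : ℝ) + 1)) ^ d := by
      have h1 : (1 : ℝ) ≤ (8 * ((d : ℝ) + 1)) * (((ρ : ℝ) + 1) / ((r : ℝ) + 1)) := by
        rw [mul_div_assoc', le_div_iff₀ hr1, one_mul]; exact hcase
      have h2 : (1 : ℝ) ≤ ((8 * ((d : ℝ) + 1)) * (((ρ : ℝ) + 1) / ((r : ℝ) + 1))) ^ d := one_le_pow₀ h1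
      rw [mul_pow] at h2
      calc (1 : ℝ) ≤ (8 * ((d : ℝ) + 1)) ^ d * (((ρ : ℝ) + 1) / ((r : ℝ) + 1)) ^ d := h2
        _ ≤ A₀ * (8 * ((d : ℝ) + 1)) ^ (d + 1) * (((ρ : ℝ) + 1) / ((r : ℝ) + 1)) ^ d := by
            rw [pow_succ]
            have hx : 0 ≤ (((ρ : ℝ) + 1) / ((r : ℝ) + 1)) ^ d := by positivity
            have hy : (8 * ((d : ℝ) + 1)) ^ d ≤ A₀ * ((8 * ((d : ℝ) + 1)) ^ d * (8 * ((d : ℝ) + 1))) := by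
              have hp : 0 ≤ (8 * ((d : ℝ) + 1)) ^ d := by positivity
              calc (8 * ((d : ℝ) + 1)) ^ d = 1 * ((8 * ((d : ℝ) + 1)) ^ d * 1) := by ring
                _ ≤ A₀ * ((8 * ((d : ℝ) + 1)) ^ d * (8 * ((d : ℝ) + 1))) :=
                    mul_le_mul hA₀1 (mul_le_mul_of_nonneg_left hd1 hp) (by positivity) (by linarith)
            exact mul_le_mul_of_nonneg_right hy hx
    calc gradSq h (box z ρ) ≤ gradSq h (box z r) := hmono
      _ = 1 * gradSq h (box z r) := (one_mul _).symm
      _ ≤ A₀ * (8 * ((d : ℝ) + 1)) ^ (d + 1) * (((ρ : ℝ) + 1) / ((r : ℝ) + 1)) ^ d * gradSq h (box z r) :=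
          mul_le_mul_of_nonneg_right hfac hEr
  · -- separated radii: the sup bound with `ℓ = ⌊(r − ρ − 2d)/(d+1)⌋`
    push Not at hcase
    have hd0 : (0 : ℝ) ≤ d := Nat.cast_nonneg d
    -- integer bookkeeping
    have hbig : 8 * ((d : ℤ) + 1) * (ρ + 1) < r + 1 := by
      have : (8 : ℝ) * ((d : ℝ) + 1) * ((ρ : ℝ) + 1) < (r : ℝ) + 1 := hcase
      exact_mod_cast this
    obtain ⟨ℓ, hℓdef⟩ : ∃ ℓ : ℕ, (ℓ : ℤ) = (r - ρ - 2 * d) / ((d : ℤ) + 1) := by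
      refine ⟨((r - ρ - 2 * d) / ((d : ℤ) + 1)).toNat, Int.toNat_of_nonneg (Int.ediv_nonneg (by nlinarith) (by positivity))⟩
    have hdpos : (0 : ℤ) < (d : ℤ) + 1 := by positivity
    have hℓlo : ((ℓ : ℤ) + 1) * ((d : ℤ) + 1) > r - ρ - 2 * d := by
      rw [hℓdef]; have := Int.lt_ediv_add_one_mul_self (r - ρ - 2 * d) hdpos; linarith
    have hℓhi : (ℓ : ℤ) * ((d : ℤ) + 1) ≤ r - ρ - 2 * d := by
      rw [hℓdef]; exact Int.ediv_mul_le _ (ne_of_gt hdpos)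
    have hℓ1 : 1 ≤ ℓ := by
      have : (1 : ℤ) ≤ ℓ := by nlinarith
      exact_mod_cast this
    -- the box of `gradSq_le_of_harmonic` fits inside `Q_r`, and its harmonicity box inside `Q_{r+1}`
    have hfit : ρ + ℓ + d * ((ℓ : ℤ) + 2) ≤ r := by nlinarith
    have hsup := gradSq_le_of_harmonic hκ hℓ1 hρ h (fun y hy => hh y (box_mono z (by linarith) hy))
    have hmono : gradSq h (box z (ρ + ℓ + d * ((ℓ : ℤ) + 2))) ≤ gradSq h (box z r) := gradSq_mono h (box_mono z hfit)
    -- constants: `(2ρ+1)^d/(ℓ+1)^d ≤ (8(d+1))^d ((ρ+1)/(r+1))^d` and `d ≤ 8(d+1)`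
    have hℓr : (r : ℝ) + 1 ≤ 4 * ((d : ℝ) + 1) * ((ℓ : ℝ) + 1) := by
      have h1 : (((ℓ : ℤ) + 1) * ((d : ℤ) + 1) : ℝ) > ((r - ρ - 2 * d : ℤ) : ℝ) := by exact_mod_cast hℓlo
      push_cast at h1
      have h2 : (8 : ℝ) * ((d : ℝ) + 1) * ((ρ : ℝ) + 1) < (r : ℝ) + 1 := hcase
      nlinarith
    have hratio : ((2 * ρ + 1 : ℤ) : ℝ) ^ d / ((ℓ : ℝ) + 1) ^ d ≤ (8 * ((d : ℝ) + 1)) ^ d * (((ρ : ℝ) + 1) / ((r : ℝ) + 1)) ^ d := by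
      rw [← div_pow, ← mul_pow]
      apply pow_le_pow_left₀ (by push_cast; positivity)
      push_cast
      have hlpos : (0 : ℝ) < (ℓ : ℝ) + 1 := by positivity
      rw [div_le_iff₀ hlpos, show 8 * ((d : ℝ) + 1) * (((ρ : ℝ) + 1) / ((r : ℝ) + 1)) * ((ℓ : ℝ) + 1) =
        8 * ((d : ℝ) + 1) * ((ρ : ℝ) + 1) * ((ℓ : ℝ) + 1) / ((r : ℝ) + 1) by ring, le_div_iff₀ hr1]
      nlinarith
    have hl0 : (0 : ℝ) < ((ℓ : ℝ) + 1) ^ d := by positivity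
    calc gradSq h (box z ρ)
        ≤ d * A₀ * ((2 * ρ + 1 : ℤ) : ℝ) ^ d / ((ℓ : ℝ) + 1) ^ d * gradSq h (box z (ρ + ℓ + d * ((ℓ : ℤ) + 2))) := by
          rw [hA₀]; exact hsup
      _ ≤ d * A₀ * ((2 * ρ + 1 : ℤ) : ℝ) ^ d / ((ℓ : ℝ) + 1) ^ d * gradSq h (box z r) :=
          mul_le_mul_of_nonneg_left hmono (by push_cast; positivity)
      _ = d * A₀ * (((2 * ρ + 1 : ℤ) : ℝ) ^ d / ((ℓ : ℝ) + 1) ^ d) * gradSq h (box z r) := by ring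
      _ ≤ (8 * ((d : ℝ) + 1)) * A₀ * ((8 * ((d : ℝ) + 1)) ^ d * (((ρ : ℝ) + 1) / ((r : ℝ) + 1)) ^ d) * gradSq h (box z r) := by
          apply mul_le_mul_of_nonneg_right _ hEr
          have hA₀0 : 0 ≤ A₀ := by linarith
          have hq0 : 0 ≤ ((2 * ρ + 1 : ℤ) : ℝ) ^ d / ((ℓ : ℝ) + 1) ^ d := by push_cast; positivity
          calc (d : ℝ) * A₀ * (((2 * ρ + 1 : ℤ) : ℝ) ^ d / ((ℓ : ℝ) + 1) ^ d)
              ≤ (8 * ((d : ℝ) + 1)) * A₀ * (((2 * ρ + 1 : ℤ) : ℝ) ^ d / ((ℓ : ℝ) + 1) ^ d) := by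
                apply mul_le_mul_of_nonneg_right _ hq0
                exact mul_le_mul_of_nonneg_right (by linarith) hA₀0
            _ ≤ (8 * ((d : ℝ) + 1)) * A₀ * ((8 * ((d : ℝ) + 1)) ^ d * (((ρ : ℝ) + 1) / ((r : ℝ) + 1)) ^ d) :=
                mul_le_mul_of_nonneg_left hratio (by positivity)
      _ = A₀ * (8 * ((d : ℝ) + 1)) ^ (d + 1) * (((ρ : ℝ) + 1) / ((r : ℝ) + 1)) ^ d * gradSq h (box z r) := by rw [pow_succ]; ring

end Literature.MathematicalPhysics.QuantumFieldTheory.Balaban1983to89.B4Eq19LatticeHarmonicDecay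

end
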